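import Literature.MathematicalPhysics.QuantumFieldTheory.Balaban1983to89.B12Transl58

/-!
# Bałaban CMP 109 (1987) §5 pp. 292–293, (5.6) and (5.7): the Euclidean covariance of the TWO-VARIABLE vacuum
polarization tensor Π_{μν}(x, y) under the axis permutations r_π, «Π_{μν}(rx, ry) = Π_{π⁻¹(μ),π⁻¹(ν)}(x, y)», and
under the reflections ε, «Π_{μν}(εx − ((1−ε_μ)/2)e_μ, εy − ((1−ε_ν)/2)e_ν) = ε_με_νΠ_{μν}(x, y)», typed as
bookkeeping from (5.2)/(5.3) (invariance of the finite-volume functional, NAMED HYPOTHESIS) ⇒ (5.4) for the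
Hessian kernel on the torus ⇒ the limit (5.1) (NAMED HYPOTHESIS); and, under (5.8)₁, their IDENTITY with the
lineage's one-variable `B12Beta.PermCovariant` / `B12Transverse536.ReflCovariant` — which discharges the two
covariance hypotheses of `…B12Transl58.moment2_eq_of_limit`

CITATION HEADER (lean-in-tree rule 2026-08-18).
* Source: T. Bałaban, "Renormalization group approach to lattice gauge field theories. I. Generation of effective
  actions in a small field approximation and a coupling constant renormalization in four dimensions", Commun. Math.
  Phys. **109** (1987) 249–301, doi:10.1007/bf01215223 [Balaban1987RG1] (cell paper B12; held:
  `paper:balaban1987-cmp109-rg-i-small-field`; PDF page = journal page − 248), §5 pp. 292–293 (5.1)–(5.8); §1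
  p. 264 (1.21).  The sentences and displays quoted below were READ AS IMAGES by the author of this file on the
  300-dpi renders of the audit cell (`HOME/b2b-balaban-ref1/pages/1987-cmp109-rg-I-small-field/…-p044-x2.png` =
  p. 292, `…-p045-x2.png` = p. 293; HOME = the cell folder `run/shared/lean/pub/pub-balaban/`) and agree with the
  lineage transcript `HOME/b2b-balaban-b03/B12s-transcript.md`; inside quotation marks nothing is altered.  Audit
  cell `pub-balaban`, unit `b2b-balaban-b03-g18` (PAPER SUB-CELL B03 → B12 §§2–5 lineage, gen 18), node
  B12-EUCLCOV-567.  Imports only the lineage's own accepted module `…B12Transl58` (gen 17: (5.8) from (5.1)/(5.2),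
  the finite-volume field space `Λ → T → V`, `transl58_of_limit`, `moment2_eq_of_symmetries`; through it
  `…B12Covariance54`: the ℤᵈ point maps `permPt`, `reflPt`, `sv`, `twist`, the lemma `twist_sub_twist` and the
  abstract (5.2) ⇒ (5.4) `hessian_invariant`); modifies nothing.
* Statements reproduced (verbatim).  p. 292 [PDF 44]: *"The function 𝐄^{(j)}(U_j(exp iB)) is invariant with
  respect to all Euclidean symmetries r of the lattice T₁^{(j)},"* (5.2) *"𝐄^{(j)}(U_j(exp irB)) = 𝐄^{(j)}(rU_j(exp iB))
  = 𝐄^{(j)}(U_j(exp iB)), where the fields rU, rB are defined by the identity (rU)(rb) = U(b), hence"* (5.3)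
  *"(rU)(b) = U(r⁻¹b), (rB)(b) = B(r⁻¹b). The invariance (5.2) yields the following covariant transformation law for
  the polarization tensor:"* (5.4) *"Π(rb, rb′) = Π(b, b′), where Π is extended to negatively oriented bonds by the
  equality Π(−b, b′) = −Π(b, b′), similarly for the second argument. We would like to get the representation (4.41)
  for the function"* (5.5) *"Π_{μν}(x, y) = Π(⟨x, x + e_μ⟩, ⟨y, y + e_ν⟩). Unfortunately the Euclidean covariance (5.4)
  takes on a more complicated form for this function. We formulate it explicitly in two special cases, which we will
  use in the sequel. If r is a transformation defined by a permutation π: (rx)_μ = x_{π⁻¹(μ)}, then the equality (5.4)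
  can be written as"* (5.6) *"Π_{μν}(rx, ry) = Π_{π⁻¹(μ),π⁻¹(ν)}(x, y) = ((r⊗r)Π)_{μν}(x, y)."*  p. 293 [PDF 45]: *"If r
  is a reflection in a part of the components of x: rx = εx, (εx)_μ = ε_μx_μ, ε_μ = ±1, μ = 1, …, d, then (5.4) can
  be written as Π(⟨εx, εx + ε_μe_μ⟩, ⟨εy, εy + ε_νe_ν⟩) = Π(⟨x, x + e_μ⟩, ⟨y, y + e_ν⟩). This and the definition (5.5)
  yield"* (5.7) *"Π_{μν}(εx − ((1−ε_μ)/2)e_μ, εy − ((1−ε_ν)/2)e_ν) = ε_με_νΠ_{μν}(x, y). The function Π is also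
  translation invariant and symmetric, hence"* (5.8) *"Π_{μν}(x, y) = Π_{μν}(x − y), Π_{μν}(x) = Π_{νμ}(−x)."*  (The
  opening of Sect. 5 with (5.1) *"Π(b, b′) = lim_{T₁^{(j)}↗Z⁴} δ²/(δB(b)δB(b′)) 𝐄^{(j)}(U_j(exp iB))|_{B=0}"* and (1.21)
  p. 264 *"Π_{j+1}(g_j, rb, rb′) = Π_{j+1}(g_j, b, b′), … r is a Euclidean rotation leaving the lattice T^{(j+1)}
  invariant"* are quoted in full in the header of `…B12Transl58`.)
* Proof route.  Print derives (5.6) in the words «can be written as» and (5.7) in the words «This and the definition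
  (5.5) yield», from (5.4), i.e. from (5.2) with the action (5.3); no argument is displayed.  The standard argument:
  (5.3) makes `r_π` and `ε` act LINEARLY (and, at finite volume, continuously) on the bond field `B`, by
  `(r_πB)_ν(y) = B_{π⁻¹(ν)}(r_π⁻¹y)` (a positively oriented `ν`-bond is the `r_π`-image of a positively oriented
  `π⁻¹(ν)`-bond) and `(εB)_ν(y) = ε_νB_ν(εy − ((1−ε_ν)/2)e_ν)` (the `ε`-preimage of `⟨y, y + e_ν⟩` is `⟨εy, εy + ε_νe_ν⟩`,
  NEGATIVELY oriented when `ε_ν = −1`, whence the sign and the half-bond shift by the odd extension «Π(−b, b′) =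
  −Π(b, b′)» — exactly the bookkeeping certified on `Z^d` by `…B12Covariance54.pull_permPt` / `pull_reflPt`); a `C²`
  function invariant under a continuous linear map `τ` has `D²f(0)(τv, τw) = D²f(0)(v, w)` (`hessian_invariant`), and
  `τ` maps the coordinate direction `δ/δB_μ(x)` to `δ/δB_{π(μ)}(r_πx)`, resp. `ε_μ·δ/δB_μ(T_μ⁻¹x)` — this is (5.4) ⇒
  (5.6), (5.7) for the finite-volume Hessian kernel; both laws are closed under the pointwise limit (5.1) once the
  projections `Z^d → T₁^{(j)}` intertwine the point maps (they do, §6); and under (5.8)₁ the two-point laws are the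
  lineage's difference-variable laws by `r_π0 = 0` and `T_μx − T_νy = R_{μν}(x − y)` (`twist_sub_twist`).  This module
  supplies exactly that, as elementary algebra/analysis (the author of this file's own short arguments, `[folklore]`),
  with (5.2) entering ONLY as the named hypotheses `hinv`/`hperm`/`hrefl` on an abstract `C²` function of the
  finite-volume field (or as the finite-volume covariances `hPermv`/`hReflv` of abstract torus kernels), and (5.1) ONLY
  as the named hypothesis `hlim` of `…B12Transl58` (pointwise limit along an arbitrary non-trivial filter of volumes).

WHY THIS NODE (the DAG edge it closes).  Gen 17 (`…B12Transl58.moment2_eq_of_limit`) reached (4.43) for print's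
two-variable Π(x, y) from (5.1) + finite-volume translation invariance and Hessian symmetry, but still ASSUMED the
covariances (5.6) `B12Beta.PermCovariant K` and (5.7) `B12Transverse536.ReflCovariant K` of the one-variable kernel
`K = Π(·, 0)` as hypotheses `hperm`, `hrefl` («(5.4) ⇒ (5.6), (5.7) for rotations and reflections at the two-variable
level» was listed there under WHAT IS NOT PROVED).  `…B12Covariance54` has the dictionary printed-(5.6)/(5.7) ↔
`PermCovariant`/`ReflCovariant` only for ONE-VARIABLE kernels, at the level of the quadratic form (5.43).  This module
types print's own route for the remaining two Euclidean covariances — finite volume (5.2)/(5.3) ⇒ (5.4) ⇒ (5.6),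
(5.7), then the limit (5.1), then (5.8)₁ — so that in the end-to-end statement only (5.9)₁ (gauge invariance, (4.15)₁)
and (5.10) (the decay, (4.37)) remain as hypotheses on `K` (`moment2_eq_of_limit_of_invariance`: from the INVARIANT
FUNCTIONAL on the tori — `C²` functions `f n` invariant under translations, direction permutations and reflections —
straight to (4.43)).  As for translations (gen 17),
a TERMWISE covariance of the polymer functions `𝐄²(X, x, y)` of (4.37) would not do (the cube partition π_j is not
invariant under `r_π`, `ε` about a general centre either); the TOTAL functional (5.1)/(5.2) is the printed carrier.

DICTIONARY (paper ↦ Lean).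
* directions `μ = 1, …, d` ↦ `Λ` (abstract at finite volume; `Fin d` on `Z^d`); sites of the torus `T₁^{(j)}` ↦ an
  arbitrary FINITE type `T` (the field space `Λ → T → V` must be a normed space), sites of `Z^d` ↦ `Pt d = Fin d → ℤ`;
  a bond field on positively oriented bonds, `B_ν(y) = B(⟨y, y + e_ν⟩)` ((5.5)), values in a normed space `V` ↦
  `B : Λ → T → V`; `𝐄^{(j)}(U_j(exp iB))` as a function of `B` ↦ an abstract `C²` function `f : (Λ → T → V) → F`.
* the permutation `r = r_π`, «(rx)_μ = x_{π⁻¹(μ)}» ↦ on `Z^d` LITERALLY `…B12Covariance54.permPt π`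
  (`permPt π x j = x (π.symm j)`), at finite volume an arbitrary bijection `r : T ≃ T` of the sites together with the
  relabelling `σ = π : Equiv.Perm Λ` of the directions (`r_πe_κ = e_{π(κ)}`); its action (5.3) on bond fields ↦
  `(τB) ν y = B (σ.symm ν) (r.symm y)` (`exists_permCLM`); (5.6) with `μ, ν ↦ π(μ), π(ν)` ↦
  `Π (σ μ) (σ ν) (r x) (r y) = Π μ ν x y`.
* the reflection `ε`, «(εx)_μ = ε_μx_μ, ε_μ = ±1»: on `Z^d` the SINGLE-AXIS reflection in the axis `ρ` (these generate
  all `ε`) ↦ `…B12Covariance54.reflPt ρ`, its signs `ε_μ` ↦ `…B12Transverse536.rsgn ρ μ` (`−1` iff `μ = ρ`), the shift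
  «((1−ε_ν)/2)e_ν» ↦ `sv ρ ν`, the point map of (5.7) «εy − ((1−ε_ν)/2)e_ν» ↦ `twist ρ ν y = reflPt ρ y − sv ρ ν`; at
  finite volume arbitrary signs `ε : Λ → 𝕜` and direction-dependent bijections `t ν : T ≃ T` (`T_ν`); the action (5.3)
  with the odd extension ↦ `(τB) ν y = ε ν • B ν (t ν y)` (`exists_reflCLM`); (5.7) ↦
  `Π μ ν (t μ x) (t ν y) = (ε μ * ε ν) • Π μ ν x y`, on `Z^d` `Π μ ν (twist ρ μ x) (twist ρ ν y) = rsgn ρ μ * rsgn ρ ν *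
  Π μ ν x y`.
* `δ/δB_μ(x)` in the charge direction `v ∈ V` ↦ the Fréchet derivative in the direction `Pi.single μ (Pi.single x v)`;
  the finite-volume tensor ↦ `fderiv 𝕜 (fderiv 𝕜 f) 0 (Pi.single μ (Pi.single x v)) (Pi.single ν (Pi.single y w))`
  (the spelling of `…B12Ward414`, `…B12Covariance54` §7, `…B12Transl58`); (5.1) ↦ the hypothesis `hlim : ∀ μ ν x y,
  Tendsto (fun n ↦ Πv n μ ν (π n x) (π n y)) l (𝓝 (Π μ ν x y))` with projections `π n : Pt d →+ Tn n`, which must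
  INTERTWINE the point maps: `π n (permPt σ x) = rn n σ (π n x)`, `π n (twist ρ ν x) = tn n ρ ν (π n x)` (hypotheses
  `hπr`, `hπt`; for the coordinate tori `(Z/N)^d`, i.e. any componentwise `φ : ℤ →+ A`, such `rn`, `tn` exist and are
  bijections: `exists_perm_intertwiner`, `exists_twist_intertwiner`).
* (5.8)₁ ↦ `Π μ ν x y = Π μ ν (x − y) 0`, the one-variable kernel `K μ ν z := Π μ ν z 0` (as in `…B12Transl58`); the
  lineage's (5.6) ↦ `B12Beta.PermCovariant K` («P (σ μ) (σ ν) (x ∘ σ.symm) = P μ ν x», and `x ∘ σ.symm = permPt σ x`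
  definitionally); the lineage's (5.7) ↦ `B12Transverse536.ReflCovariant K` (`K μ ν (reflTwist ρ μ ν z) = rsgn ρ μ *
  rsgn ρ ν * K μ ν z`, `reflTwist ρ μ ν (x − y) = twist ρ μ x − twist ρ ν y`).

WHAT IS PROVED (kernel-checked, no `sorry`, standard axioms; every declaration is `[folklore]` algebra/analysis ABOUT
the printed objects, or carries the printed locus it transcribes; the module is definition-free).
1. §1 (limits, any index/point types, Hausdorff values, any `NeBot` filter of volumes): `permCov_of_tendsto` — a
   (5.6)-type law `Πₙ (σ μ) (σ ν) (r x) (r y) = Πₙ μ ν x y` for all `n` passes to the pointwise limit;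
   `reflCov_of_tendsto` — a (5.7)-type law `Πₙ μ ν (T_μ x) (T_ν y) = c μ ν * Πₙ μ ν x y` passes to the pointwise limit.
2. §2 (transport): `permCov_pullback`, `reflCov_pullback` — a covariant kernel on the torus pulled back along a
   projection intertwining the point maps is covariant on `Z^d`.
3. §3 (finite volume, (5.2)/(5.3) ⇒ (5.4) ⇒ (5.6), (5.7)): `exists_permCLM`, `exists_reflCLM` (the two (5.3)-actions
   are continuous linear maps of `Λ → T → V`); `hessian_perm_pi` — `f ∈ C²` invariant under the `r_π`-action ⇒
   `H_{π(μ)π(ν)}(r_πx, r_πy) = H_{μν}(x, y)` for the Hessian kernel `H` in the bond directions (charge directions `v`,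
   `w`); `hessian_refl_pi` — invariant under the `ε`-action ⇒ `H_{μν}(T_μx, T_νy) = ε_με_ν·H_{μν}(x, y)` (bilinearity
   moves the signs out; `ε_ν² = 1` is not even needed); `cov567_finiteVolume` — both, packaged for families of
   permutations and reflections and the kernel `H_{μν}(x, y) = δ²f/δB_μ(x)δB_ν(y)|_{B=0}`.
4. §4 (on `Z^d`): `permCovariant_kernel` / `permCov_iff_permCovariant` — two-variable (5.6) ⇒ `PermCovariant K`, and
   ⇔ under (5.8)₁; `reflCovariant_kernel` / `reflCov_iff_reflCovariant` — two-variable single-axis (5.7) + (5.8)₁ ⇒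
   `ReflCovariant K`, and ⇔ (via `twist_sub_twist`); `cov567_of_limit` — finite-volume (5.6), (5.7) on the tori +
   intertwining projections + (5.1) ⇒ two-variable (5.6), (5.7) on `Z^d`; `symmetries_of_limit` — together with
   gen 17's `transl58_of_limit`: (5.8)₁, (5.8)₂, `PermCovariant K`, `ReflCovariant K` for the limit tensor, i.e. ALL
   of (5.6)–(5.8); `moment2_eq_of_limit_cov` — END TO END: (5.1) + finite-volume translation invariance, symmetry,
   `r_π`- and `ε`-covariance + for `K` ONLY (5.9)₁ `WardFirst` and (5.10) `Decay510` ⇒ (4.43)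
   `Σ_y Π_{μν}(x, y)(y_κ − x_κ)(y_λ − x_λ) = β(δ_{μκ}δ_{νλ} + δ_{μλ}δ_{νκ} − 2δ_{μν}δ_{κλ})`, (4.45) `Σ_y Π_{μν}(x, y)(y_κ −
   x_κ) = 0` and `Σ_y Π_{μν}(x, y) = 0` (`…B12Transl58.moment2_eq_of_symmetries` & co. with `hperm`, `hrefl` discharged:
   `moment2_eq_of_cov` is the two-variable-hypotheses form on `Z^d`, no limit).
5. §5 (from the invariant functional, `𝕜 = ℝ`, print's signs `ε = rsgn ρ`): `cov567_finiteVolume_rsgn` (finite volume,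
   all direction permutations and the single-axis reflections); `cov567_of_limit_of_invariance` — per volume a `C²`
   function `f n` of `B : Fin d → Tn n → V` invariant (5.2) under the (5.3)-actions of the permutations and reflections,
   `Πv n` ITS Hessian kernel at `0`, intertwining projections, (5.1) ⇒ two-variable (5.6), (5.7) on `Z^d`;
   `symmetries_of_limit_of_invariance` — adding translation invariance of `f n` (`…B12Transl58.eq121_finiteVolume`):
   ALL of (5.6)–(5.8) for the limit tensor; `moment2_eq_of_limit_of_invariance` — END TO END FROM (5.2): the same three
   invariances of `f n` + (5.1) + for `K` only (5.9)₁ and (5.10) ⇒ (4.43), (4.45), `Σ_y Π = 0`.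
6. §6 (the hypotheses `hπr`, `hπt` are met by the paper's volumes): for every additive `φ : ℤ →+ A` acting
   componentwise (`φ.compLeft (Fin d) : Pt d →+ (Fin d → A)`; `A = ZMod N` is the torus `(Z/N)^d`),
   `exists_perm_intertwiner` (the coordinate permutation of `A^d`) and `exists_twist_intertwiner` (the involution
   `y ↦ εy − φ(((1−ε_ν)/2)e_ν)` of `A^d`) intertwine `permPt σ`, resp. `twist ρ ν`, with BIJECTIONS of the torus.

WHAT IS NOT PROVED HERE (and not claimed).  (5.2) itself (the Euclidean invariance of the minimiser `U_j` and of
`𝐄^{(j)}`, print's inductive hypothesis (1.19) and [15]) and the existence of the limit (5.1) — hypotheses, exactly as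
asserted in print; the identification of the series (4.37) with the limit (5.1); (5.7) on `Z^d` for a SIMULTANEOUS
reflection of several axes (the composite of single-axis ones, which is all the lineage's `ReflCovariant` uses — at
finite volume `hessian_refl_pi` allows arbitrary signs `ε_ν`); that the ACTUAL `𝐄^{(j)}(U_j(exp iB))` of the paper
is `C²` in `B` and Euclidean invariant (the abstract `f n` with `hf`, `hftransl`, `hfperm`, `hfrefl` stands for it —
named hypotheses); (5.9) from (4.15)₁ at the two-variable level and
(5.10) from (4.37) (they stay hypotheses `hward`, `h510`; cf. `…B12Covariance54.wardFirst_iff_gauge_left`,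
`…B12Transl58.decay510_tsum437`); the colour structure `δ^{ab}`.

HONEST FRAMING: value = kernel certificate of two displayed lines of printed bookkeeping ((5.6), (5.7) from
(5.2)–(5.5), at finite volume and in the limit) plus the by-name discharge of two hypotheses inside the lineage's DAG;
NOT a reproduction of any estimate of the paper, NOT summit progress (the host summit — continuum Yang–Mills with mass
gap — is untouched).
-/

namespace Literature.MathematicalPhysics.QuantumFieldTheory.Balaban1983to89.B12EuclCov567

open Literature.MathematicalPhysics.QuantumFieldTheory.GawedzkiKupiainen1985.PeriodicGleason (Pt unitVec)
open Literature.MathematicalPhysics.QuantumFieldTheory.Balaban1983to89.B12Sec2to5 (Decay510)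
open Literature.MathematicalPhysics.QuantumFieldTheory.Balaban1983to89.B12Transverse536 (ReflCovariant WardFirst
  rsgn reflTwist)
open Literature.MathematicalPhysics.QuantumFieldTheory.Balaban1983to89.B12Marginal444 (kdA)
open Literature.MathematicalPhysics.QuantumFieldTheory.Balaban1983to89.B12Covariance54 (permPt permPt_zero
  permPt_sub reflPt reflPt_self reflPt_of_ne sv twist twist_sub_twist hessian_invariant)
open Literature.MathematicalPhysics.QuantumFieldTheory.Balaban1983to89.B12Transl58 (apply_eq_apply_sub_zero
  swap_kernel eq121_finiteVolume transl58_of_limit moment2_eq_of_symmetries moment1_eq_zero_of_symmetries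
  moment0_eq_zero_of_symmetries)
open Filter
open _root_.Topology

/-! ## §1 Covariance relations of two-variable kernels pass to pointwise limits -/

section Limit

variable {Λ X α : Type*} [TopologicalSpace α] [T2Space α] {ι : Type*} {l : Filter ι} [l.NeBot]
  {Pn : ι → Λ → Λ → X → X → α} {P : Λ → Λ → X → X → α}

/-- **(5.6)-type covariance passes to pointwise limits**: if every finite-volume kernel satisfies
`Π⁽ⁿ⁾_{σμ,σν}(rx, ry) = Π⁽ⁿ⁾_{μν}(x, y)` for a relabelling `σ` of the directions and a map `r` of the points, so does
their pointwise limit (Hausdorff values, any non-trivial filter of volumes). [folklore] (the step (5.4)/(5.6)-at-finite-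
volume ⇒ (5.6) for the limit (5.1), p.292 of Balaban1987RG1) -/
theorem permCov_of_tendsto (σ : Λ → Λ) (r : X → X)
    (hn : ∀ n μ ν x y, Pn n (σ μ) (σ ν) (r x) (r y) = Pn n μ ν x y)
    (hlim : ∀ μ ν x y, Tendsto (fun n => Pn n μ ν x y) l (𝓝 (P μ ν x y))) (μ ν : Λ) (x y : X) :
    P (σ μ) (σ ν) (r x) (r y) = P μ ν x y :=
  tendsto_nhds_unique ((hlim (σ μ) (σ ν) (r x) (r y)).congr fun n => hn n μ ν x y) (hlim μ ν x y)

/-- **(5.7)-type covariance passes to pointwise limits**: if every finite-volume kernel satisfies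
`Π⁽ⁿ⁾_{μν}(T_μx, T_νy) = c_{μν}·Π⁽ⁿ⁾_{μν}(x, y)` for direction-dependent point maps `T_μ` and constants `c_{μν}` (the signs
`ε_με_ν`), so does their pointwise limit (values in a Hausdorff space with continuous multiplication). [folklore] (the
step (5.4)/(5.7)-at-finite-volume ⇒ (5.7) for the limit (5.1), pp.292–293 of Balaban1987RG1) -/
theorem reflCov_of_tendsto [Mul α] [ContinuousMul α] (t : Λ → X → X) (c : Λ → Λ → α)
    (hn : ∀ n μ ν x y, Pn n μ ν (t μ x) (t ν y) = c μ ν * Pn n μ ν x y)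
    (hlim : ∀ μ ν x y, Tendsto (fun n => Pn n μ ν x y) l (𝓝 (P μ ν x y))) (μ ν : Λ) (x y : X) :
    P μ ν (t μ x) (t ν y) = c μ ν * P μ ν x y :=
  tendsto_nhds_unique (hlim μ ν (t μ x) (t ν y))
    (((hlim μ ν x y).const_mul (c μ ν)).congr fun n => (hn n μ ν x y).symm)

end Limit

/-! ## §2 Transport of a finite-volume covariance along the projection `Z^d → T₁^{(j)}` -/

section Transport

variable {Λ G H α : Type*}

/-- **Pull-back of a (5.6)-type covariance along a projection intertwining the point maps**: if
`π ∘ r_G = r_H ∘ π` and the kernel `Πv` on `H` (the torus) is `(σ, r_H)`-covariant, then the pulled-back kernel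
`(x, y) ↦ Πv(πx, πy)` on `G` (the infinite lattice) is `(σ, r_G)`-covariant. [folklore] -/
theorem permCov_pullback (π : G → H) {Pv : Λ → Λ → H → H → α} (σ : Λ → Λ) {rG : G → G} {rH : H → H}
    (hπ : ∀ x, π (rG x) = rH (π x)) (hcov : ∀ μ ν x y, Pv (σ μ) (σ ν) (rH x) (rH y) = Pv μ ν x y)
    (μ ν : Λ) (x y : G) : Pv (σ μ) (σ ν) (π (rG x)) (π (rG y)) = Pv μ ν (π x) (π y) := by
  rw [hπ, hπ, hcov]

/-- **Pull-back of a (5.7)-type covariance along a projection intertwining the direction-dependent point maps.**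
[folklore] -/
theorem reflCov_pullback [Mul α] (π : G → H) {Pv : Λ → Λ → H → H → α} {tG : Λ → G → G} {tH : Λ → H → H}
    (c : Λ → Λ → α) (hπ : ∀ ν x, π (tG ν x) = tH ν (π x))
    (hcov : ∀ μ ν x y, Pv μ ν (tH μ x) (tH ν y) = c μ ν * Pv μ ν x y) (μ ν : Λ) (x y : G) :
    Pv μ ν (π (tG μ x)) (π (tG ν y)) = c μ ν * Pv μ ν (π x) (π y) := by
  rw [hπ, hπ, hcov]

end Transport

/-! ## §3 Finite volume: (5.2) with the actions (5.3) of `r_π` and `ε` ⇒ (5.4) ⇒ (5.6), (5.7) for the Hessian kernel -/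

section Hessian

variable {𝕜 : Type*} [NontriviallyNormedField 𝕜] {F : Type*} [NormedAddCommGroup F] [NormedSpace 𝕜 F]
  {Λ T V : Type*} [NormedAddCommGroup V] [NormedSpace 𝕜 V]

/-- **(5.3) for an axis permutation `r = r_π` is a continuous linear map of the finite-volume field space**:
`(r_πB)(b) = B(r_π⁻¹b)`, i.e. `(r_πB)_ν(y) = B_{π⁻¹(ν)}(r_π⁻¹y)` (a positive `ν`-bond is the image of a positive
`π⁻¹(ν)`-bond: no sign — the shape certified on `Z^d` by `…B12Covariance54.pull_permPt`), for any relabelling `σ = π`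
of the directions and any bijection `r` of the sites. [cite: Balaban1987RG1, (5.3) p.292 and (5.6) p.292] -/
theorem exists_permCLM (σ : Equiv.Perm Λ) (r : T ≃ T) :
    ∃ τ : (Λ → T → V) →L[𝕜] (Λ → T → V), ∀ B ν y, τ B ν y = B (σ.symm ν) (r.symm y) :=
  ⟨{ toFun := fun B ν y => B (σ.symm ν) (r.symm y)
     map_add' := fun _ _ => rfl
     map_smul' := fun _ _ => rfl
     cont := continuous_pi fun ν => continuous_pi fun y =>
       (continuous_apply (r.symm y)).comp (continuous_apply (σ.symm ν)) }, fun _ _ _ => rfl⟩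

/-- **(5.3) for a reflection `r = ε` is a continuous linear map of the finite-volume field space**:
`(εB)(b) = B(ε⁻¹b)` with `B` odd under bond reversal, i.e. `(εB)_ν(y) = ε_ν B_ν(εy − ((1−ε_ν)/2)e_ν)` (the reflected
axis' bonds reverse orientation: sign `ε_ν` and the half-bond shift — the shape certified on `Z^d` by
`…B12Covariance54.pull_reflPt`), for any signs `ε_ν` and any direction-dependent bijections `T_ν` of the sites.
[cite: Balaban1987RG1, (5.3) p.292 and (5.7) p.293] -/
theorem exists_reflCLM (ε : Λ → 𝕜) (t : Λ → T ≃ T) :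
    ∃ τ : (Λ → T → V) →L[𝕜] (Λ → T → V), ∀ B ν y, τ B ν y = ε ν • B ν (t ν y) :=
  ⟨{ toFun := fun B ν y => ε ν • B ν (t ν y)
     map_add' := fun B B' => funext fun ν => funext fun y => by
       show ε ν • (B ν (t ν y) + B' ν (t ν y)) = ε ν • B ν (t ν y) + ε ν • B' ν (t ν y)
       rw [smul_add]
     map_smul' := fun c B => funext fun ν => funext fun y => by
       show ε ν • (c • B ν (t ν y)) = c • (ε ν • B ν (t ν y))
       exact smul_comm _ _ _
     cont := continuous_pi fun ν => continuous_pi fun y => by fun_prop }, fun _ _ _ => rfl⟩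

variable [Fintype Λ] [Fintype T] [DecidableEq Λ] [DecidableEq T]

/-- **(5.2) ⇒ (5.4) ⇒ (5.6) for the Hessian kernel on the torus**: if the `C²` function `f` («𝐄^{(j)}(U_j(exp iB))»
as a function of `B`) is invariant under the action (5.3) of the axis permutation `r = r_π` («(rB)(b) = B(r⁻¹b)»,
`(r_πB)_ν(y) = B_{π⁻¹(ν)}(r_π⁻¹y)`), then its Hessian at `0` in the bond directions `δ/δB_μ(x)` (charge direction `v`),
`δ/δB_ν(y)` (charge direction `w`) satisfies `H_{π(μ)π(ν)}(r_πx, r_πy) = H_{μν}(x, y)`, i.e. «Π_{μν}(rx, ry) =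
Π_{π⁻¹(μ),π⁻¹(ν)}(x, y)». [cite: Balaban1987RG1, (5.2)-(5.4) and (5.6) p.292] -/
theorem hessian_perm_pi {f : (Λ → T → V) → F} (hf : ContDiff 𝕜 2 f) (σ : Equiv.Perm Λ) (r : T ≃ T)
    (hinv : ∀ B : Λ → T → V, f (fun ν y => B (σ.symm ν) (r.symm y)) = f B)
    (μ ν : Λ) (x y : T) (v w : V) :
    fderiv 𝕜 (fderiv 𝕜 f) 0 (Pi.single (σ μ) (Pi.single (r x) v)) (Pi.single (σ ν) (Pi.single (r y) w)) =
      fderiv 𝕜 (fderiv 𝕜 f) 0 (Pi.single μ (Pi.single x v)) (Pi.single ν (Pi.single y w)) := by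
  obtain ⟨τ, hτ⟩ := exists_permCLM (𝕜 := 𝕜) (V := V) σ r
  have hτ' : ∀ B, τ B = fun ν y => B (σ.symm ν) (r.symm y) :=
    fun B => funext fun ν => funext fun y => hτ B ν y
  have hinv' : f ∘ τ = f := funext fun B => by rw [Function.comp_apply, hτ', hinv]
  have hs : ∀ (κ : Λ) (z : T) (u : V),
      τ (Pi.single κ (Pi.single z u)) = Pi.single (σ κ) (Pi.single (r z) u) := by
    intro κ z u
    rw [hτ']
    funext κ' y'
    by_cases hκ : κ' = σ κ
    · subst hκ
      simp [Pi.single_apply, Equiv.symm_apply_eq]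
    · have hκ' : σ.symm κ' ≠ κ := fun h => hκ (σ.symm_apply_eq.1 h)
      simp [hκ, hκ']
  rw [← hs μ x v, ← hs ν y w]
  exact hessian_invariant hf τ hinv' _ _

/-- **(5.2) ⇒ (5.4) ⇒ (5.7) for the Hessian kernel on the torus**: if the `C²` function `f` is invariant under the
action (5.3) of the reflection `ε` («(rB)(b) = B(r⁻¹b)» with the odd extension to reversed bonds:
`(εB)_ν(y) = ε_νB_ν(T_νy)`, `T_νy = εy − ((1−ε_ν)/2)e_ν`), then its Hessian at `0` in the bond directions satisfies
«Π_{μν}(εx − ((1−ε_μ)/2)e_μ, εy − ((1−ε_ν)/2)e_ν) = ε_με_νΠ_{μν}(x, y)»: `H_{μν}(T_μx, T_νy) = ε_με_ν·H_{μν}(x, y)`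
(bilinearity of the Hessian moves the signs out; no hypothesis `ε_ν² = 1` is needed for this direction).
[cite: Balaban1987RG1, (5.2)-(5.4) p.292 and (5.7) p.293] -/
theorem hessian_refl_pi {f : (Λ → T → V) → F} (hf : ContDiff 𝕜 2 f) (ε : Λ → 𝕜) (t : Λ → T ≃ T)
    (hinv : ∀ B : Λ → T → V, f (fun ν y => ε ν • B ν (t ν y)) = f B)
    (μ ν : Λ) (x y : T) (v w : V) :
    fderiv 𝕜 (fderiv 𝕜 f) 0 (Pi.single μ (Pi.single (t μ x) v)) (Pi.single ν (Pi.single (t ν y) w)) =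
      (ε μ * ε ν) • fderiv 𝕜 (fderiv 𝕜 f) 0 (Pi.single μ (Pi.single x v)) (Pi.single ν (Pi.single y w)) := by
  obtain ⟨τ, hτ⟩ := exists_reflCLM (V := V) ε t
  have hτ' : ∀ B, τ B = fun ν y => ε ν • B ν (t ν y) :=
    fun B => funext fun ν => funext fun y => hτ B ν y
  have hinv' : f ∘ τ = f := funext fun B => by rw [Function.comp_apply, hτ', hinv]
  have hs : ∀ (κ : Λ) (z : T) (u : V),
      τ (Pi.single κ (Pi.single (t κ z) u)) = ε κ • Pi.single κ (Pi.single z u) := by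
    intro κ z u
    rw [hτ']
    funext κ' y'
    by_cases hκ : κ' = κ
    · subst hκ
      simp [Pi.single_apply]
    · simp [hκ]
  calc fderiv 𝕜 (fderiv 𝕜 f) 0 (Pi.single μ (Pi.single (t μ x) v)) (Pi.single ν (Pi.single (t ν y) w))
      = fderiv 𝕜 (fderiv 𝕜 f) 0 (τ (Pi.single μ (Pi.single (t μ x) v))) (τ (Pi.single ν (Pi.single (t ν y) w))) :=
        (hessian_invariant hf τ hinv' _ _).symm
    _ = fderiv 𝕜 (fderiv 𝕜 f) 0 (ε μ • Pi.single μ (Pi.single x v)) (ε ν • Pi.single ν (Pi.single y w)) := by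
        rw [hs, hs]
    _ = (ε μ * ε ν) • fderiv 𝕜 (fderiv 𝕜 f) 0 (Pi.single μ (Pi.single x v)) (Pi.single ν (Pi.single y w)) := by
        simp only [map_smul, smul_apply, smul_smul, mul_comm]

/-- **(5.6) and (5.7) AT FINITE VOLUME, packaged**: for a `C²` function `f` of the bond field `B : Λ → T → V`
invariant under the (5.3)-actions of a family of axis permutations (`σ_s`, `r_s`) and of a family of reflections
(`ε_ρ`, `T_ρ`), the Hessian kernel `H_{μν}(x, y) = δ²f/δB_μ(x)δB_ν(y)|_{B=0}` (charge direction `v` in both slots)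
satisfies `H_{σμ,σν}(r x, r y) = H_{μν}(x, y)` and `H_{μν}(T_μx, T_νy) = ε_με_ν·H_{μν}(x, y)`.
[cite: Balaban1987RG1, (5.2)-(5.6) p.292, (5.7) p.293; (1.21) p.264] -/
theorem cov567_finiteVolume {f : (Λ → T → V) → F} (hf : ContDiff 𝕜 2 f) (v : V)
    {S : Type*} (σ : S → Equiv.Perm Λ) (r : S → T ≃ T)
    (hperm : ∀ s (B : Λ → T → V), f (fun ν y => B ((σ s).symm ν) ((r s).symm y)) = f B)
    {R : Type*} (ε : R → Λ → 𝕜) (t : R → Λ → T ≃ T)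
    (hrefl : ∀ ρ (B : Λ → T → V), f (fun ν y => ε ρ ν • B ν (t ρ ν y)) = f B)
    {H : Λ → Λ → T → T → F}
    (hH : ∀ μ ν x y,
      H μ ν x y = fderiv 𝕜 (fderiv 𝕜 f) 0 (Pi.single μ (Pi.single x v)) (Pi.single ν (Pi.single y v))) :
    (∀ s μ ν x y, H (σ s μ) (σ s ν) (r s x) (r s y) = H μ ν x y) ∧
      ∀ ρ μ ν x y, H μ ν (t ρ μ x) (t ρ ν y) = (ε ρ μ * ε ρ ν) • H μ ν x y :=
  ⟨fun s μ ν x y => by rw [hH, hH]; exact hessian_perm_pi hf (σ s) (r s) (hperm s) μ ν x y v v,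
    fun ρ μ ν x y => by rw [hH, hH]; exact hessian_refl_pi hf (ε ρ) (t ρ) (hrefl ρ) μ ν x y v v⟩

end Hessian

/-! ## §4 On `Z^d`: two-variable (5.6)/(5.7) versus the lineage's one-variable `PermCovariant` / `ReflCovariant` -/

section Lattice

variable {d : ℕ} {P : Fin d → Fin d → Pt d → Pt d → ℝ}

/-- **Two-variable (5.6) ⇒ `B12Beta.PermCovariant` of the one-variable kernel `K_{μν}(z) = Π_{μν}(z, 0)`** (no
translation invariance needed: `r_π0 = 0`). [cite: Balaban1987RG1, (5.6) p.292 and (5.8) p.293; (1.21) p.264] -/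
theorem permCovariant_kernel
    (hperm : ∀ (σ : Equiv.Perm (Fin d)) μ ν x y, P (σ μ) (σ ν) (permPt σ x) (permPt σ y) = P μ ν x y) :
    B12Beta.PermCovariant fun μ ν z => P μ ν z 0 := by
  intro σ μ ν z
  show P (σ μ) (σ ν) (permPt σ z) 0 = P μ ν z 0
  have h := hperm σ μ ν z 0
  rwa [permPt_zero] at h

/-- **Under (5.8)₁, two-variable (5.6) ⇔ `B12Beta.PermCovariant` of `K = Π(·, 0)`.**
[cite: Balaban1987RG1, (5.6) p.292 and (5.8) p.293] -/
theorem permCov_iff_permCovariant (hT : ∀ μ ν a x y, P μ ν (x + a) (y + a) = P μ ν x y) :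
    (∀ (σ : Equiv.Perm (Fin d)) μ ν x y, P (σ μ) (σ ν) (permPt σ x) (permPt σ y) = P μ ν x y) ↔
      B12Beta.PermCovariant fun μ ν z => P μ ν z 0 := by
  refine ⟨permCovariant_kernel, fun h σ μ ν x y => ?_⟩
  rw [apply_eq_apply_sub_zero (hT (σ μ) (σ ν)) (permPt σ x), ← permPt_sub,
    apply_eq_apply_sub_zero (hT μ ν) x y]
  exact h σ μ ν (x - y)

/-- **Two-variable (5.7) + (5.8)₁ ⇒ `B12Transverse536.ReflCovariant` of `K = Π(·, 0)`**: by
`…B12Covariance54.twist_sub_twist` (`T_{ρ;μ}x − T_{ρ;ν}y = R_{ρ;μν}(x − y)`) the printed two-point law is the lineage's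
difference-variable law `K_{μν}(R_{ρ;μν}z) = ε_με_νK_{μν}(z)`. [cite: Balaban1987RG1, (5.7) and (5.8) p.293] -/
theorem reflCovariant_kernel (hT : ∀ μ ν a x y, P μ ν (x + a) (y + a) = P μ ν x y)
    (hrefl : ∀ ρ μ ν x y, P μ ν (twist ρ μ x) (twist ρ ν y) = rsgn ρ μ * rsgn ρ ν * P μ ν x y) :
    ReflCovariant fun μ ν z => P μ ν z 0 := by
  intro ρ μ ν z
  show P μ ν (reflTwist ρ μ ν z) 0 = rsgn ρ μ * rsgn ρ ν * P μ ν z 0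
  have h := hrefl ρ μ ν z 0
  rwa [apply_eq_apply_sub_zero (hT μ ν) (twist ρ μ z), twist_sub_twist, sub_zero] at h

/-- **Under (5.8)₁, two-variable (5.7) ⇔ `B12Transverse536.ReflCovariant` of `K = Π(·, 0)`.**
[cite: Balaban1987RG1, (5.7) and (5.8) p.293] -/
theorem reflCov_iff_reflCovariant (hT : ∀ μ ν a x y, P μ ν (x + a) (y + a) = P μ ν x y) :
    (∀ ρ μ ν x y, P μ ν (twist ρ μ x) (twist ρ ν y) = rsgn ρ μ * rsgn ρ ν * P μ ν x y) ↔
      ReflCovariant fun μ ν z => P μ ν z 0 := by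
  refine ⟨reflCovariant_kernel hT, fun h ρ μ ν x y => ?_⟩
  rw [apply_eq_apply_sub_zero (hT μ ν) (twist ρ μ x), twist_sub_twist, apply_eq_apply_sub_zero (hT μ ν) x y]
  exact h ρ μ ν (x - y)

variable {ι : Type*} {l : Filter ι} [l.NeBot] {Tn : ι → Type*} [∀ n, AddCommGroup (Tn n)]

/-- **(5.1) + (5.4)-for-`r_π`,`ε`-at-finite-volume ⇒ two-variable (5.6), (5.7) for the infinite-volume tensor on
`Z^d`**: the finite-volume tensors `Πv n` on the tori `Tn n` are covariant under point maps `rn n σ` / `tn n ρ ν` which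
the projections `π n : Z^d →+ Tn n` INTERTWINE with `r_σ = permPt σ` / `T_{ρ;ν} = twist ρ ν` (named hypotheses `hπr`,
`hπt`; satisfiable for the coordinate tori, §6), and `Π` is the pointwise limit (5.1) (`hlim`).
[cite: Balaban1987RG1, (5.1)-(5.6) p.292, (5.7) p.293] -/
theorem cov567_of_limit (π : ∀ n, Pt d →+ Tn n) {Pv : ∀ n, Fin d → Fin d → Tn n → Tn n → ℝ}
    (hlim : ∀ μ ν x y, Tendsto (fun n => Pv n μ ν (π n x) (π n y)) l (𝓝 (P μ ν x y)))
    (rn : ∀ n, Equiv.Perm (Fin d) → Tn n → Tn n) (hπr : ∀ n σ x, π n (permPt σ x) = rn n σ (π n x))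
    (hPermv : ∀ n (σ : Equiv.Perm (Fin d)) μ ν x y, Pv n (σ μ) (σ ν) (rn n σ x) (rn n σ y) = Pv n μ ν x y)
    (tn : ∀ n, Fin d → Fin d → Tn n → Tn n) (hπt : ∀ n ρ ν x, π n (twist ρ ν x) = tn n ρ ν (π n x))
    (hReflv : ∀ n ρ μ ν x y, Pv n μ ν (tn n ρ μ x) (tn n ρ ν y) = rsgn ρ μ * rsgn ρ ν * Pv n μ ν x y) :
    (∀ (σ : Equiv.Perm (Fin d)) μ ν x y, P (σ μ) (σ ν) (permPt σ x) (permPt σ y) = P μ ν x y) ∧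
      ∀ ρ μ ν x y, P μ ν (twist ρ μ x) (twist ρ ν y) = rsgn ρ μ * rsgn ρ ν * P μ ν x y :=
  ⟨fun σ => permCov_of_tendsto (Pn := fun n μ ν x y => Pv n μ ν (π n x) (π n y)) σ (permPt σ)
      (fun n μ ν x y => permCov_pullback (π n) σ (hπr n σ) (hPermv n σ) μ ν x y) hlim,
    fun ρ => reflCov_of_tendsto (Pn := fun n μ ν x y => Pv n μ ν (π n x) (π n y)) (twist ρ)
      (fun μ ν => rsgn ρ μ * rsgn ρ ν)
      (fun n μ ν x y => reflCov_pullback (π n) (fun μ ν => rsgn ρ μ * rsgn ρ ν) (hπt n ρ) (hReflv n ρ) μ ν x y)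
      hlim⟩

/-- **ALL THE SYMMETRIES (5.6)–(5.8) OF THE LIMIT TENSOR FROM (5.1) + FINITE-VOLUME (5.4)**: translation invariance,
symmetry, `r_π`- and `ε`-covariance of the finite-volume tensors + the pointwise limit (5.1) through intertwining
projections ⇒ on `Z^d`: (5.8)₁ `Π_{μν}(x, y) = K_{μν}(x − y)` with `K = Π(·, 0)`, (5.8)₂ `K_{μν}(z) = K_{νμ}(−z)`,
(5.6) `B12Beta.PermCovariant K`, (5.7) `B12Transverse536.ReflCovariant K` — the four kernel hypotheses of the lineage's
§5 modules other than (5.9), (5.10). [cite: Balaban1987RG1, (5.1)-(5.6) p.292, (5.7)-(5.8) p.293; (1.21) p.264] -/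
theorem symmetries_of_limit (π : ∀ n, Pt d →+ Tn n) {Pv : ∀ n, Fin d → Fin d → Tn n → Tn n → ℝ}
    (hTv : ∀ n μ ν b x y, Pv n μ ν (x + b) (y + b) = Pv n μ ν x y)
    (hSv : ∀ n μ ν x y, Pv n μ ν x y = Pv n ν μ y x)
    (hlim : ∀ μ ν x y, Tendsto (fun n => Pv n μ ν (π n x) (π n y)) l (𝓝 (P μ ν x y)))
    (rn : ∀ n, Equiv.Perm (Fin d) → Tn n → Tn n) (hπr : ∀ n σ x, π n (permPt σ x) = rn n σ (π n x))
    (hPermv : ∀ n (σ : Equiv.Perm (Fin d)) μ ν x y, Pv n (σ μ) (σ ν) (rn n σ x) (rn n σ y) = Pv n μ ν x y)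
    (tn : ∀ n, Fin d → Fin d → Tn n → Tn n) (hπt : ∀ n ρ ν x, π n (twist ρ ν x) = tn n ρ ν (π n x))
    (hReflv : ∀ n ρ μ ν x y, Pv n μ ν (tn n ρ μ x) (tn n ρ ν y) = rsgn ρ μ * rsgn ρ ν * Pv n μ ν x y) :
    (∀ μ ν x y, P μ ν x y = P μ ν (x - y) 0) ∧ (∀ μ ν z, P μ ν z 0 = P ν μ (-z) 0) ∧
      B12Beta.PermCovariant (fun μ ν z => P μ ν z 0) ∧ ReflCovariant (fun μ ν z => P μ ν z 0) := by
  obtain ⟨hT, hS⟩ := transl58_of_limit π hTv hSv hlim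
  obtain ⟨hp, hr⟩ := cov567_of_limit π hlim rn hπr hPermv tn hπt hReflv
  exact ⟨fun μ ν => apply_eq_apply_sub_zero (hT μ ν), swap_kernel hT hS, permCovariant_kernel hp,
    reflCovariant_kernel hT hr⟩

variable {C₁ δ₁ : ℝ} {μ₀ ν₀ : Fin d}

/-- **(4.43), (4.45) and `Σ_y Π = 0` FOR THE TWO-VARIABLE TENSOR FROM ITS TWO-VARIABLE SYMMETRIES**: translation
invariance (5.8)₁, the printed two-point laws (5.6) and (5.7), and for `K = Π(·, 0)` only the Ward identity (5.9)₁
`WardFirst` and the decay (5.10) `Decay510` ⇒ `Σ_y Π_{μν}(x, y)(y_κ − x_κ)(y_λ − x_λ) = β(δ_{μκ}δ_{νλ} + δ_{μλ}δ_{νκ} −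
2δ_{μν}δ_{κλ})`, `β = Σ_z K_{μ₀ν₀}(z)z_{μ₀}z_{ν₀}` (`μ₀ ≠ ν₀`), `Σ_y Π_{μν}(x, y)(y_κ − x_κ) = 0`, `Σ_y Π_{μν}(x, y) = 0` —
`…B12Transl58.moment2_eq_of_symmetries` & co. with their hypotheses `PermCovariant K`, `ReflCovariant K` discharged by
`permCovariant_kernel`, `reflCovariant_kernel`.
[cite: Balaban1987RG1, (5.6) p.292, (5.7)-(5.10) p.293, (4.43) p.291, (4.45) p.292, (5.42) p.297] -/
theorem moment2_eq_of_cov (hT : ∀ μ ν a x y, P μ ν (x + a) (y + a) = P μ ν x y)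
    (hperm : ∀ (σ : Equiv.Perm (Fin d)) μ ν x y, P (σ μ) (σ ν) (permPt σ x) (permPt σ y) = P μ ν x y)
    (hrefl : ∀ ρ μ ν x y, P μ ν (twist ρ μ x) (twist ρ ν y) = rsgn ρ μ * rsgn ρ ν * P μ ν x y)
    (hδ : 0 < δ₁) (h510 : ∀ μ ν, Decay510 (fun z => P μ ν z 0) C₁ δ₁)
    (hward : WardFirst fun μ ν z => P μ ν z 0) (h0 : μ₀ ≠ ν₀) (x : Pt d) (μ ν κ l : Fin d) :
    ∑' y, P μ ν x y * (((y κ - x κ : ℤ) : ℝ) * ((y l - x l : ℤ) : ℝ)) =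
        B12Beta.secondMoment (fun μ ν z => P μ ν z 0) μ₀ ν₀ *
          (kdA μ κ * kdA ν l + kdA μ l * kdA ν κ - 2 * kdA μ ν * kdA κ l) ∧
      ∑' y, P μ ν x y * ((y κ - x κ : ℤ) : ℝ) = 0 ∧ ∑' y, P μ ν x y = 0 :=
  ⟨moment2_eq_of_symmetries hT hδ h510 (permCovariant_kernel hperm) (reflCovariant_kernel hT hrefl) hward h0
      x μ ν κ l,
    moment1_eq_zero_of_symmetries hT hδ h510 (permCovariant_kernel hperm) (reflCovariant_kernel hT hrefl) hward h0
      x μ ν κ,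
    moment0_eq_zero_of_symmetries hT hδ h510 (permCovariant_kernel hperm) (reflCovariant_kernel hT hrefl) hward h0
      x μ ν⟩

/-- **END TO END, v2 of `…B12Transl58.moment2_eq_of_limit` with (5.6), (5.7) DISCHARGED from finite volume**:
(5.1) + finite-volume translation invariance, symmetry, `r_π`- and `ε`-covariance (through intertwining projections)
+ for `K = Π(·, 0)` ONLY the Ward identity (5.9)₁ `WardFirst` and the decay (5.10) `Decay510` ⇒ (4.43) for the
two-variable infinite-volume tensor: `Σ_y Π_{μν}(x, y)(y_κ − x_κ)(y_λ − x_λ) = β(δ_{μκ}δ_{νλ} + δ_{μλ}δ_{νκ} − 2δ_{μν}δ_{κλ})`,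
`β = Σ_z K_{μ₀ν₀}(z)z_{μ₀}z_{ν₀}` (`μ₀ ≠ ν₀`), together with (4.45) `Σ_y Π_{μν}(x, y)(y_κ − x_κ) = 0` and `Σ_y Π_{μν}(x, y) = 0`.
[cite: Balaban1987RG1, (5.1)-(5.6) p.292, (5.7)-(5.10) p.293, (4.43) p.291, (4.45) p.292, (5.42) p.297] -/
theorem moment2_eq_of_limit_cov (π : ∀ n, Pt d →+ Tn n) {Pv : ∀ n, Fin d → Fin d → Tn n → Tn n → ℝ}
    (hTv : ∀ n μ ν b x y, Pv n μ ν (x + b) (y + b) = Pv n μ ν x y)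
    (hSv : ∀ n μ ν x y, Pv n μ ν x y = Pv n ν μ y x)
    (hlim : ∀ μ ν x y, Tendsto (fun n => Pv n μ ν (π n x) (π n y)) l (𝓝 (P μ ν x y)))
    (rn : ∀ n, Equiv.Perm (Fin d) → Tn n → Tn n) (hπr : ∀ n σ x, π n (permPt σ x) = rn n σ (π n x))
    (hPermv : ∀ n (σ : Equiv.Perm (Fin d)) μ ν x y, Pv n (σ μ) (σ ν) (rn n σ x) (rn n σ y) = Pv n μ ν x y)
    (tn : ∀ n, Fin d → Fin d → Tn n → Tn n) (hπt : ∀ n ρ ν x, π n (twist ρ ν x) = tn n ρ ν (π n x))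
    (hReflv : ∀ n ρ μ ν x y, Pv n μ ν (tn n ρ μ x) (tn n ρ ν y) = rsgn ρ μ * rsgn ρ ν * Pv n μ ν x y)
    (hδ : 0 < δ₁) (h510 : ∀ μ ν, Decay510 (fun z => P μ ν z 0) C₁ δ₁)
    (hward : WardFirst fun μ ν z => P μ ν z 0) (h0 : μ₀ ≠ ν₀) (x : Pt d) (μ ν κ l : Fin d) :
    ∑' y, P μ ν x y * (((y κ - x κ : ℤ) : ℝ) * ((y l - x l : ℤ) : ℝ)) =
        B12Beta.secondMoment (fun μ ν z => P μ ν z 0) μ₀ ν₀ *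
          (kdA μ κ * kdA ν l + kdA μ l * kdA ν κ - 2 * kdA μ ν * kdA κ l) ∧
      ∑' y, P μ ν x y * ((y κ - x κ : ℤ) : ℝ) = 0 ∧ ∑' y, P μ ν x y = 0 := by
  obtain ⟨hT, _⟩ := transl58_of_limit π hTv hSv hlim
  obtain ⟨hp, hr⟩ := cov567_of_limit π hlim rn hπr hPermv tn hπt hReflv
  exact moment2_eq_of_cov hT hp hr hδ h510 hward h0 x μ ν κ l

end Lattice

/-! ## §5 From the invariant functional: (5.2) for the `C²` functions `𝐄^{(j)}(U_j(exp iB))` on the tori ⇒ (5.6)–(5.8)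
and (4.43) for the limit (5.1) on `Z^d` -/

section Functional

variable {d : ℕ} {V : Type*} [NormedAddCommGroup V] [NormedSpace ℝ V]

/-- **Finite volume, real field space with print's signs**: `…cov567_finiteVolume` for `𝕜 = F = ℝ`, direction set
`Fin d`, the family of ALL direction permutations and the single-axis sign vectors `ε = rsgn ρ` of the lineage
(`ε_ρ = −1`, `ε_ν = 1` otherwise): (5.2) for the actions (5.3) ⇒ `H_{σμ,σν}(r_σx, r_σy) = H_{μν}(x, y)` and
`H_{μν}(t_{ρ;μ}x, t_{ρ;ν}y) = ε_με_ν H_{μν}(x, y)` for the Hessian kernel `H` of `f` at `0`.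
[cite: Balaban1987RG1, (5.2)-(5.6) p.292, (5.7) p.293; (1.20)-(1.21) p.264] -/
theorem cov567_finiteVolume_rsgn {T : Type*} [Fintype T] [DecidableEq T] {f : (Fin d → T → V) → ℝ}
    (hf : ContDiff ℝ 2 f) (v : V) (r : Equiv.Perm (Fin d) → T ≃ T)
    (hfperm : ∀ (σ : Equiv.Perm (Fin d)) (B : Fin d → T → V), f (fun ν y => B (σ.symm ν) ((r σ).symm y)) = f B)
    (t : Fin d → Fin d → T ≃ T)
    (hfrefl : ∀ ρ (B : Fin d → T → V), f (fun ν y => rsgn ρ ν • B ν (t ρ ν y)) = f B)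
    {H : Fin d → Fin d → T → T → ℝ}
    (hH : ∀ μ ν x y,
      H μ ν x y = fderiv ℝ (fderiv ℝ f) 0 (Pi.single μ (Pi.single x v)) (Pi.single ν (Pi.single y v))) :
    (∀ (σ : Equiv.Perm (Fin d)) μ ν x y, H (σ μ) (σ ν) (r σ x) (r σ y) = H μ ν x y) ∧
      ∀ ρ μ ν x y, H μ ν (t ρ μ x) (t ρ ν y) = rsgn ρ μ * rsgn ρ ν * H μ ν x y := by
  obtain ⟨hp, hr⟩ := cov567_finiteVolume hf v (fun σ : Equiv.Perm (Fin d) => σ) r hfperm rsgn t hfrefl hH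
  exact ⟨hp, fun ρ μ ν x y => by rw [hr, smul_eq_mul]⟩

variable {P : Fin d → Fin d → Pt d → Pt d → ℝ} {ι : Type*} {l : Filter ι} [l.NeBot] {Tn : ι → Type*}
  [∀ n, AddCommGroup (Tn n)] [∀ n, Fintype (Tn n)] [∀ n, DecidableEq (Tn n)]

/-- **(5.2) on the tori + (5.1) ⇒ two-variable (5.6), (5.7) on `Z^d`**: for every volume `n` a `C²` function `f n` of
the bond field `B : Fin d → Tn n → V` (print's `B ↦ 𝐄^{(j)}(U_j(exp iB))`) invariant (5.2) under the actions (5.3) of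
the direction permutations `σ` (site maps `rn n σ`) and of the reflections (site maps `tn n ρ ν`, signs `ε = rsgn ρ`),
its Hessian kernel `Πv n` at `B = 0` ((5.1) before the limit, charge direction `v`), projections `π n : Z^d →+ Tn n`
intertwining `permPt σ` / `twist ρ ν` with `rn n σ` / `tn n ρ ν` (satisfiable: §6), and the pointwise limit (5.1) `Π`
(`hlim`) ⇒ `Π_{σμ,σν}(r_σx, r_σy) = Π_{μν}(x, y)` and `Π_{μν}(T_{ρ;μ}x, T_{ρ;ν}y) = ε_με_νΠ_{μν}(x, y)`.
[cite: Balaban1987RG1, (5.1)-(5.6) p.292, (5.7) p.293] -/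
theorem cov567_of_limit_of_invariance (π : ∀ n, Pt d →+ Tn n) {f : ∀ n, (Fin d → Tn n → V) → ℝ}
    (hf : ∀ n, ContDiff ℝ 2 (f n)) (v : V) {Pv : ∀ n, Fin d → Fin d → Tn n → Tn n → ℝ}
    (hH : ∀ n μ ν x y, Pv n μ ν x y =
      fderiv ℝ (fderiv ℝ (f n)) 0 (Pi.single μ (Pi.single x v)) (Pi.single ν (Pi.single y v)))
    (hlim : ∀ μ ν x y, Tendsto (fun n => Pv n μ ν (π n x) (π n y)) l (𝓝 (P μ ν x y)))
    (rn : ∀ n, Equiv.Perm (Fin d) → Tn n ≃ Tn n) (hπr : ∀ n σ x, π n (permPt σ x) = rn n σ (π n x))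
    (hfperm : ∀ n (σ : Equiv.Perm (Fin d)) (B : Fin d → Tn n → V),
      f n (fun ν y => B (σ.symm ν) ((rn n σ).symm y)) = f n B)
    (tn : ∀ n, Fin d → Fin d → Tn n ≃ Tn n) (hπt : ∀ n ρ ν x, π n (twist ρ ν x) = tn n ρ ν (π n x))
    (hfrefl : ∀ n ρ (B : Fin d → Tn n → V), f n (fun ν y => rsgn ρ ν • B ν (tn n ρ ν y)) = f n B) :
    (∀ (σ : Equiv.Perm (Fin d)) μ ν x y, P (σ μ) (σ ν) (permPt σ x) (permPt σ y) = P μ ν x y) ∧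
      ∀ ρ μ ν x y, P μ ν (twist ρ μ x) (twist ρ ν y) = rsgn ρ μ * rsgn ρ ν * P μ ν x y :=
  cov567_of_limit π hlim (fun n σ => rn n σ) hπr
    (fun n => (cov567_finiteVolume_rsgn (hf n) v (rn n) (hfperm n) (tn n) (hfrefl n) (hH n)).1)
    (fun n ρ ν => tn n ρ ν) hπt
    (fun n => (cov567_finiteVolume_rsgn (hf n) v (rn n) (hfperm n) (tn n) (hfrefl n) (hH n)).2)

/-- **ALL OF (5.6)–(5.8) FOR THE LIMIT TENSOR FROM (5.2)**: per volume a `C²` function `f n` invariant under the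
translations, the direction permutations and the reflections (actions (5.3)), `Πv n` its Hessian kernel at `0`,
intertwining projections and the pointwise limit (5.1) ⇒ on `Z^d`: (5.8)₁ `Π_{μν}(x, y) = K_{μν}(x − y)`
(`K = Π(·, 0)`), (5.8)₂ `K_{μν}(z) = K_{νμ}(−z)`, (5.6) `B12Beta.PermCovariant K`, (5.7) `ReflCovariant K`; the
finite-volume translation invariance and symmetry are `…B12Transl58.eq121_finiteVolume` (Hessian symmetry:
`𝕜 = ℝ`). [cite: Balaban1987RG1, (5.1)-(5.6) p.292, (5.7)-(5.8) p.293; (1.20)-(1.21) p.264] -/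
theorem symmetries_of_limit_of_invariance (π : ∀ n, Pt d →+ Tn n) {f : ∀ n, (Fin d → Tn n → V) → ℝ}
    (hf : ∀ n, ContDiff ℝ 2 (f n)) (v : V) {Pv : ∀ n, Fin d → Fin d → Tn n → Tn n → ℝ}
    (hH : ∀ n μ ν x y, Pv n μ ν x y =
      fderiv ℝ (fderiv ℝ (f n)) 0 (Pi.single μ (Pi.single x v)) (Pi.single ν (Pi.single y v)))
    (hlim : ∀ μ ν x y, Tendsto (fun n => Pv n μ ν (π n x) (π n y)) l (𝓝 (P μ ν x y)))
    (hftransl : ∀ n (a : Tn n) (B : Fin d → Tn n → V), f n (fun μ y => B μ (y - a)) = f n B)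
    (rn : ∀ n, Equiv.Perm (Fin d) → Tn n ≃ Tn n) (hπr : ∀ n σ x, π n (permPt σ x) = rn n σ (π n x))
    (hfperm : ∀ n (σ : Equiv.Perm (Fin d)) (B : Fin d → Tn n → V),
      f n (fun ν y => B (σ.symm ν) ((rn n σ).symm y)) = f n B)
    (tn : ∀ n, Fin d → Fin d → Tn n ≃ Tn n) (hπt : ∀ n ρ ν x, π n (twist ρ ν x) = tn n ρ ν (π n x))
    (hfrefl : ∀ n ρ (B : Fin d → Tn n → V), f n (fun ν y => rsgn ρ ν • B ν (tn n ρ ν y)) = f n B) :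
    (∀ μ ν x y, P μ ν x y = P μ ν (x - y) 0) ∧ (∀ μ ν z, P μ ν z 0 = P ν μ (-z) 0) ∧
      B12Beta.PermCovariant (fun μ ν z => P μ ν z 0) ∧ ReflCovariant (fun μ ν z => P μ ν z 0) :=
  symmetries_of_limit π (fun n => (eq121_finiteVolume (hf n) (hftransl n) v (hH n)).1)
    (fun n => (eq121_finiteVolume (hf n) (hftransl n) v (hH n)).2.1) hlim (fun n σ => rn n σ) hπr
    (fun n => (cov567_finiteVolume_rsgn (hf n) v (rn n) (hfperm n) (tn n) (hfrefl n) (hH n)).1)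
    (fun n ρ ν => tn n ρ ν) hπt
    (fun n => (cov567_finiteVolume_rsgn (hf n) v (rn n) (hfperm n) (tn n) (hfrefl n) (hH n)).2)

variable {C₁ δ₁ : ℝ} {μ₀ ν₀ : Fin d}

/-- **END TO END FROM (5.2): (4.43), (4.45) and `Σ_y Π = 0` for the limit tensor**, with ALL the Euclidean
hypotheses of `…B12Transl58.moment2_eq_of_symmetries` discharged from the invariant functional at finite volume —
per volume a `C²` function `f n` of the bond field invariant under translations, direction permutations and
reflections (5.2)/(5.3), `Πv n` its Hessian kernel at `0`, intertwining projections, the pointwise limit (5.1), and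
for `K = Π(·, 0)` only the Ward identity (5.9)₁ `WardFirst` (gauge invariance, `…B12Ward414`) and the decay (5.10)
`Decay510` ((4.37), `…B12Transl58.decay510_tsum437`) ⇒ `Σ_y Π_{μν}(x, y)(y_κ − x_κ)(y_λ − x_λ) = β(δ_{μκ}δ_{νλ} +
δ_{μλ}δ_{νκ} − 2δ_{μν}δ_{κλ})`, `Σ_y Π_{μν}(x, y)(y_κ − x_κ) = 0`, `Σ_y Π_{μν}(x, y) = 0`.
[cite: Balaban1987RG1, (5.1)-(5.6) p.292, (5.7)-(5.10) p.293, (4.43) p.291, (4.45) p.292; (1.20)-(1.22) p.264] -/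
theorem moment2_eq_of_limit_of_invariance (π : ∀ n, Pt d →+ Tn n) {f : ∀ n, (Fin d → Tn n → V) → ℝ}
    (hf : ∀ n, ContDiff ℝ 2 (f n)) (v : V) {Pv : ∀ n, Fin d → Fin d → Tn n → Tn n → ℝ}
    (hH : ∀ n μ ν x y, Pv n μ ν x y =
      fderiv ℝ (fderiv ℝ (f n)) 0 (Pi.single μ (Pi.single x v)) (Pi.single ν (Pi.single y v)))
    (hlim : ∀ μ ν x y, Tendsto (fun n => Pv n μ ν (π n x) (π n y)) l (𝓝 (P μ ν x y)))
    (hftransl : ∀ n (a : Tn n) (B : Fin d → Tn n → V), f n (fun μ y => B μ (y - a)) = f n B)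
    (rn : ∀ n, Equiv.Perm (Fin d) → Tn n ≃ Tn n) (hπr : ∀ n σ x, π n (permPt σ x) = rn n σ (π n x))
    (hfperm : ∀ n (σ : Equiv.Perm (Fin d)) (B : Fin d → Tn n → V),
      f n (fun ν y => B (σ.symm ν) ((rn n σ).symm y)) = f n B)
    (tn : ∀ n, Fin d → Fin d → Tn n ≃ Tn n) (hπt : ∀ n ρ ν x, π n (twist ρ ν x) = tn n ρ ν (π n x))
    (hfrefl : ∀ n ρ (B : Fin d → Tn n → V), f n (fun ν y => rsgn ρ ν • B ν (tn n ρ ν y)) = f n B)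
    (hδ : 0 < δ₁) (h510 : ∀ μ ν, Decay510 (fun z => P μ ν z 0) C₁ δ₁)
    (hward : WardFirst fun μ ν z => P μ ν z 0) (h0 : μ₀ ≠ ν₀) (x : Pt d) (μ ν κ l : Fin d) :
    ∑' y, P μ ν x y * (((y κ - x κ : ℤ) : ℝ) * ((y l - x l : ℤ) : ℝ)) =
        B12Beta.secondMoment (fun μ ν z => P μ ν z 0) μ₀ ν₀ *
          (kdA μ κ * kdA ν l + kdA μ l * kdA ν κ - 2 * kdA μ ν * kdA κ l) ∧
      ∑' y, P μ ν x y * ((y κ - x κ : ℤ) : ℝ) = 0 ∧ ∑' y, P μ ν x y = 0 := by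
  obtain ⟨hT, _⟩ := transl58_of_limit π (fun n => (eq121_finiteVolume (hf n) (hftransl n) v (hH n)).1)
    (fun n => (eq121_finiteVolume (hf n) (hftransl n) v (hH n)).2.1) hlim
  obtain ⟨hp, hr⟩ := cov567_of_limit_of_invariance π hf v hH hlim rn hπr hfperm tn hπt hfrefl
  exact moment2_eq_of_cov hT hp hr hδ h510 hward h0 x μ ν κ l

end Functional

/-! ## §6 The coordinate tori qualify: the intertwining hypotheses are met by the componentwise projections -/

section Torus

variable {d : ℕ} {A : Type*} [AddCommGroup A] (φ : ℤ →+ A)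

/-- **The projection `Z^d → (Z/N)^d` (componentwise reduction; any componentwise additive map `φ`) intertwines the axis
permutation `r_π` of `Z^d` with a bijection of the torus** (the same coordinate permutation). Hence `hπr` of
`cov567_of_limit` holds for the volumes `T₁^{(j)}` of the paper. [folklore] (about (5.1)/(5.6) p.292 of Balaban1987RG1) -/
theorem exists_perm_intertwiner (σ : Equiv.Perm (Fin d)) :
    ∃ r : (Fin d → A) ≃ (Fin d → A), ∀ x : Pt d, φ.compLeft (Fin d) (permPt σ x) = r (φ.compLeft (Fin d) x) :=
  ⟨{ toFun := fun y j => y (σ.symm j)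
     invFun := fun y j => y (σ j)
     left_inv := fun y => funext fun j => by simp
     right_inv := fun y => funext fun j => by simp }, fun _ => rfl⟩

/-- **The same projection intertwines the twisted reflection `T_{ρ;ν}y = εy − ((1−ε_ν)/2)e_ν` of `Z^d` with a
bijection (an involution) of the torus** (`y ↦ εy − φ(((1−ε_ν)/2)e_ν)`). Hence `hπt` of `cov567_of_limit` holds for
the volumes of the paper. [folklore] (about (5.1)/(5.7) pp.292–293 of Balaban1987RG1) -/
theorem exists_twist_intertwiner (ρ ν : Fin d) :
    ∃ t : (Fin d → A) ≃ (Fin d → A), ∀ x : Pt d, φ.compLeft (Fin d) (twist ρ ν x) = t (φ.compLeft (Fin d) x) := by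
  classical
  set c : Fin d → A := φ.compLeft (Fin d) (sv ρ ν) with hc_def
  have hc : ∀ j, j ≠ ρ → c j = 0 := by
    intro j hj
    by_cases hν : ν = ρ
    · simp [hc_def, AddMonoidHom.compLeft, sv, hν, unitVec, hj]
    · simp [hc_def, AddMonoidHom.compLeft, sv, hν]
  let g : (Fin d → A) → (Fin d → A) := fun y => Function.update y ρ (-y ρ) - c
  have hg : Function.Involutive g := by
    intro y
    funext j
    by_cases hj : j = ρ
    · subst hj
      simp [g]
    · simp [g, hj, hc j hj]
  refine ⟨hg.toPerm g, fun x => ?_⟩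
  rw [Function.Involutive.coe_toPerm]
  funext j
  by_cases hj : j = ρ
  · subst hj
    simp [g, hc_def, AddMonoidHom.compLeft, twist, reflPt_self]
  · simp [g, hc_def, AddMonoidHom.compLeft, twist, hj]

end Torus

end Literature.MathematicalPhysics.QuantumFieldTheory.Balaban1983to89.B12EuclCov567
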